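import Summits.CriticalPhenomena.PercolationContinuityZ3.Theorems.Transplant.KNCellsProcess
import Literature.Probability.Percolation.KozmaNitzanSteps
import HarnessLib

/-!
# F8 (generic), part 4a — the failure bound (33) over anchored cells: the setting of one examination, the events of Step IV, the
# transfer to the weighting of (30) (BLUEPRINT-I-PHI §3 Φ12; generalises `L/KozmaNitzanSteps.lean` ll. 240–312 and 1296–1522 from `zdGraph d`
# to an anchored cell geometry; design HOME/prim-bschramm-p2-g2/F8-DESIGN.md §5)

builds on p205010 (kernel theorem, internal audit signed; external expert review pending) — nothing in this file uses p205010.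
Lane `prim-bschramm`, seat `prim-bschramm-p2` (task F8 Steps-over-cells, lead 08:19Z); helper file (`--supports stmt-CriticalPhenomena-4575`).

Kozma–Nitzan's Step IV (pp. 29–31) works under the weighting `μ = Wfull` (the graph weighting pinned on the recorded pattern of the explored
edges and restricted to `E_i ∪ E_{w,v} ∪ E_{v,x}`) with the events `A'_j` (the face `F^{j+1}` is reached inside `E_i ∪ E_{w,v} ∪ H^{j+1}`),
`B_j` (the conditional probability of reaching `F^{j+1}` given the pairs of level `j` is `≤ 1 - δ₂`) and `G_j = ⋂_{i<j} (A'_i ∩ B_i)`.  With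
ANCHORS every one of these is indexed by the source anchor `a` and a FIXED candidate departure anchor `a'`; the departure anchor actually chosen
by the configuration is the event `Dev a'` (determined by the pairs of `E_i ∪ E_{w,v}`, which lie in the conditioned pairs of every level), so
that the chain (36) runs at each fixed `a'` with `Dev a'` as an extra conditioning event (part 4b).  The faces and the full corridor are extra
data `FaceData` (stmt's note 08:15Z); KN's subbox `Q_v ∪ E_{v,x}` is `bigD a a'` (arrival anchor for `Q_v`, departure anchor for `E_{v,x}`).

* §1 `FaceData`, `StepsGeom` (faces inside stubs, stubs inside the corridor, the corridor inside `Q_v ∪ E_{v,x}`), `CellGeom.bigD`;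
* §2 `Wfull`, `Reach`, `Aface`, `Fp`, `Bev`, `Gch` (`G_j`), `badA` (bad at a fixed departure anchor), `Dev`; static inclusions;
* §3 determination / measurability; consequences of `Valid`; the almost-sure facts under `μ`;
* §4 **`pinW_Wfull_eq_Wt`** — `μ` pinned on the pairs of level `j` along a lattice pattern extending `ω|_{E_i}` is the weighting of (30).
[cite: KozmaNitzan2024, §4 pp. 29–31 (Steps II–IV, (36)) — the ℤ^d model] [cite: GrimmettPercolation1999, §7.2]
-/

noncomputable section

open MeasureTheory ProbabilityTheory
open scoped ENNReal Classical

namespace Summit.CriticalPhenomena.PercolationContinuityZ3.Theorems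

namespace Transplant

namespace KNCells

open Literature.Probability.Percolation Literature.Probability.LatticeModels SimpleGraph GadgetSystem ProbeHistory HSiteScheme Contour

variable {V : Type*} [DecidableEq V]

/-! ## §1 Faces, the full corridor, the subbox of Step III -/

/-- **Face data** for an anchored cell geometry (KN p. 26, p. 30): the faces `F^j_{v,x}` (far faces of the stubs) and the full corridor
`H_{v,x}`, anchored at the departure anchor of `v`. [cite: KozmaNitzan2024, §4 p. 26 (H_{v,x}), p. 30 (F^j_{v,x})] -/
structure FaceData (V A : Type*) where
  /-- the face `F^j_{v,x}` of the stub `H^j_{v,x}` -/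
  Face : A → Site 2 → MDir → ℕ → Finset V
  /-- the full corridor `H_{v,x} ⊇ H^K_{v,x}` -/
  Hfull : A → Site 2 → MDir → Finset V

/-- **The geometric facts of the faces and the corridor** used by Step IV: faces inside stubs, stubs inside the corridor (levels `≤ K`), the
corridor inside `Q_v ∪ E_{v,x}` (departure anchor admissible for the arrival anchor of `Q_v`), the target cube inside `E_{v,x}`.
[cite: KozmaNitzan2024, §4 pp. 26, 30] -/
structure StepsGeom {A : Type*} (Γ : CellGeom V A) (FD : FaceData V A) : Prop where
  Face_subset_Stub : ∀ a v δ j, FD.Face a v δ j ⊆ Γ.Stub a v δ j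
  Stub_subset_Hfull : ∀ a v δ j, j ≤ Γ.K → Γ.Stub a v δ j ⊆ FD.Hfull a v δ
  Hfull_subset : ∀ a a' v δ, a' ∈ Γ.anchSet a v → FD.Hfull a' v δ ⊆ Γ.Q a v ∪ Γ.Efar a' v δ
  M_tgt_subset_Efar : ∀ a v δ, Γ.M a (v + stepVec δ) ⊆ Γ.Efar a v δ

omit [DecidableEq V] in
/-- KN's subbox `D = Q_v ∪ E_{v,x}` with anchors: `Q_v` at the arrival anchor `a`, `E_{v,x}` at the departure anchor `a'`.
[cite: KozmaNitzan2024, §4 p. 31 (D = E_{v,x} ∪ Q_v)] -/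
def CellGeom.bigD {A : Type*} (Γ : CellGeom V A) (a a' : A) (v : Site 2) (δ : MDir) : Finset V := Γ.Q a v ∪ Γ.Efar a' v δ

/-! ## §2 The weighting `μ` and the events of Step IV, at a fixed departure anchor -/

namespace KSchA

variable {A : Type*} (G : SimpleGraph V) [G.LocallyFinite] (S : KSchA V A) (FD : FaceData V A)

/-- **`μ`**: the graph weighting pinned on `ω|_{E_i}` and restricted to `E_i ∪ E_{w,v} ∪ E_{v,x}` (KN's `Ω` restricted, p. 28).
[cite: KozmaNitzan2024, §4 p. 28 (Ω)] -/
def Wfull (h : ProbeHistory V) (e : Site 2 × MDir) (a a' : A) (du : MDir) : Sym2 V → unitInterval :=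
  restrW (↑(S.Sx G h e a a' du) : Set V) (pinW (KNLevels.lattW G S.p) ↑(S.F G h) ↑(S.ξ G h))

/-- `{root ↔ M_x in E_i ∪ E_{w,v} ∪ H_{v,x}}`. [cite: KozmaNitzan2024, §4 p. 30 (Step IV)] -/
def Reach (h : ProbeHistory V) (e : Site 2 × MDir) (a a' : A) (du : MDir) : Set (BondConfig V) :=
  ⋃ t ∈ (↑(S.Γ.M a' (tgt e + stepVec du)) : Set V),
    openConnIn (↑(S.Vx G h ∪ S.Γ.Ewv a e.1 e.2 ∪ FD.Hfull a' (tgt e) du) : Set V) S.Γ.root t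

/-- `A'_j = {root ↔ F^{j+1}_{v,x} in E_i ∪ E_{w,v} ∪ H^{j+1}_{v,x}}`. [cite: KozmaNitzan2024, §4 p. 30 (B_j)] -/
def Aface (h : ProbeHistory V) (e : Site 2 × MDir) (a a' : A) (du : MDir) (j : ℕ) : Set (BondConfig V) :=
  ⋃ t ∈ (↑(FD.Face a' (tgt e) du (j + 1)) : Set V),
    openConnIn (↑(S.Vx G h ∪ S.Γ.Ewv a e.1 e.2 ∪ S.Γ.Stub a' (tgt e) du (j + 1)) : Set V) S.Γ.root t

/-- The pairs inside `E_i ∪ E_{w,v} ∪ H^j_{v,x}` (the coordinates conditioned on in `B_j`). [cite: KozmaNitzan2024, §4 p. 30 (B_j)] -/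
def Fp (h : ProbeHistory V) (e : Site 2 × MDir) (a a' : A) (du : MDir) (j : ℕ) : Finset (Sym2 V) :=
  KNLevels.pairsF (S.Vx G h ∪ S.Γ.Ewv a e.1 e.2 ∪ S.Γ.Stub a' (tgt e) du j)

/-- **`B_j`** `= {P(root ↔ F^{j+1} | ω|_{E_i ∪ E_{w,v} ∪ H^j}) ≤ 1 - δ₂}`, the conditional probability being that of (30) at level `j` for the
observation `ω`, at the fixed departure anchor `a'`. [cite: KozmaNitzan2024, §4 p. 30 (B_j)] -/
def Bev (h : ProbeHistory V) (e : Site 2 × MDir) (a a' : A) (du : MDir) (j : ℕ) (δ₂ : ℝ) : Set (BondConfig V) :=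
  {ω | (prodBernoulli (S.Wt G h e a a' du j (obs ω (S.env G h e a)))).real
      (⋃ b ∈ FD.Face a' (tgt e) du (j + 1), openConn S.Γ.root b) ≤ 1 - δ₂}

/-- `G_j = ⋂_{i<j} (A'_i ∩ B_i)`. [cite: KozmaNitzan2024, §4 p. 31 ((36))] -/
def Gch (h : ProbeHistory V) (e : Site 2 × MDir) (a a' : A) (du : MDir) (δ₂ : ℝ) : ℕ → Set (BondConfig V)
  | 0 => Set.univ
  | j + 1 => S.Aface G FD h e a a' du j ∩ (S.Bev G FD h e a a' du j δ₂ ∩ Gch h e a a' du δ₂ j)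

/-- **A bad direction at the fixed departure anchor `a'`**: the connection is good at no level. [cite: KozmaNitzan2024, §4 p. 27 (j_x), p. 31] -/
def badA (h : ProbeHistory V) (e : Site 2 × MDir) (a a' : A) (du : MDir) : Set (BondConfig V) :=
  {ω | ∀ j < S.Γ.K, ¬S.cond G h e a a' du j (obs ω (S.env G h e a))}

/-- **The departure anchor chosen by the configuration is `a'`.** [folklore] -/
def Dev (h : ProbeHistory V) (e : Site 2 × MDir) (a a' : A) : Set (BondConfig V) :=
  {ω | S.depA G h e a (obs ω (S.env G h e a)) = a'}

variable {G S FD}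

omit [DecidableEq V] in
/-- `pairsF` is monotone. [folklore] -/
theorem pairsF_mono [DecidableEq V] {D D' : Finset V} (h : D ⊆ D') : KNLevels.pairsF D ⊆ KNLevels.pairsF D' := by
  intro x hx
  rw [← Finset.mem_coe, KNLevels.coe_pairsF] at hx ⊢
  exact KozmaNitzan.wireSet_mono (Finset.coe_subset.2 h) hx

/-- The edges of `G` inside `D` are pairs inside `D`. [folklore] -/
theorem edgesIn_subset_pairsF (D : Finset V) : edgesIn G D ⊆ KNLevels.pairsF D := by
  intro x hx
  rw [← Finset.mem_coe, KNLevels.coe_pairsF]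
  induction x using Sym2.ind with
  | h a b =>
    rw [mem_edgesIn_iff] at hx
    exact mk_mem_wireSet_iff.2 ⟨Finset.mem_coe.2 (hx.2 a (Sym2.mem_mk_left _ _)), Finset.mem_coe.2 (hx.2 b (Sym2.mem_mk_right _ _)),
      ((SimpleGraph.mem_edgeSet G).1 hx.1).ne⟩

omit [G.LocallyFinite] in
/-- `lattOnly` is antitone in the set. [folklore] -/
theorem lattOnly_anti {D D' : Finset V} (h : D ⊆ D') : KNLevels.lattOnly G D' ⊆ KNLevels.lattOnly G D :=
  fun _ hω x hx hxω => hω x (pairsF_mono h hx) hxω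

omit [G.LocallyFinite] in
/-- `lattOnly D` is determined by the pairs inside `D`. [folklore] -/
theorem determinedBy_lattOnly (D : Finset V) : DeterminedBy (KNLevels.lattOnly G D) (↑(KNLevels.pairsF D) : Set (Sym2 V)) := by
  rw [determinedBy_iff]
  intro ω ω' hω
  simp only [KNLevels.lattOnly, Set.mem_setOf_eq]
  refine forall₂_congr fun e he => ?_
  have := Set.ext_iff.1 hω e
  simp only [Set.mem_inter_iff, Finset.mem_coe] at this
  rw [show (e ∈ ω ↔ e ∈ ω') from ⟨fun h' => (this.1 ⟨h', he⟩).1, fun h' => (this.2 ⟨h', he⟩).1⟩]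

section Geometry

variable (hSt : StepsGeom S.Γ FD)
include hSt

/-- `E_i ∪ E_{w,v} ∪ H_{v,x} ⊆ E_i ∪ E_{w,v} ∪ E_{v,x}` (departure anchor admissible). [folklore] -/
theorem regionH_subset_Sx (h : ProbeHistory V) (e : Site 2 × MDir) {a a' : A} (ha' : a' ∈ S.Γ.anchSet a (tgt e)) (du : MDir) :
    S.Vx G h ∪ S.Γ.Ewv a e.1 e.2 ∪ FD.Hfull a' (tgt e) du ⊆ S.Sx G h e a a' du := by
  intro y hy
  rcases Finset.mem_union.1 hy with hy | hy
  · exact Finset.mem_union_left _ hy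
  · rcases Finset.mem_union.1 (hSt.Hfull_subset _ _ _ _ ha' hy) with hy | hy
    · exact Finset.mem_union_left _ (Finset.mem_union_right _ (Finset.mem_union_right _ hy))
    · exact Finset.mem_union_right _ hy

/-- `E_i ∪ E_{w,v} ∪ H^j ⊆ E_i ∪ E_{w,v} ∪ H` for `j ≤ K`. [folklore] -/
theorem region_subset_regionH (h : ProbeHistory V) (e : Site 2 × MDir) (a a' : A) (du : MDir) {j : ℕ} (hj : j ≤ S.Γ.K) :
    S.Vx G h ∪ S.Γ.Ewv a e.1 e.2 ∪ S.Γ.Stub a' (tgt e) du j ⊆ S.Vx G h ∪ S.Γ.Ewv a e.1 e.2 ∪ FD.Hfull a' (tgt e) du :=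
  Finset.union_subset_union le_rfl (hSt.Stub_subset_Hfull _ _ _ _ hj)

/-- `E_i ∪ E_{w,v} ∪ H^j ⊆ E_i ∪ E_{w,v} ∪ E_{v,x}` for `j ≤ K`. [folklore] -/
theorem region_subset_Sx (h : ProbeHistory V) (e : Site 2 × MDir) {a a' : A} (ha' : a' ∈ S.Γ.anchSet a (tgt e)) (du : MDir) {j : ℕ}
    (hj : j ≤ S.Γ.K) : S.Vx G h ∪ S.Γ.Ewv a e.1 e.2 ∪ S.Γ.Stub a' (tgt e) du j ⊆ S.Sx G h e a a' du :=
  (region_subset_regionH hSt h e a a' du hj).trans (regionH_subset_Sx hSt h e ha' du)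

/-- The pairs of level `j ≤ K` lie inside `E_i ∪ E_{w,v} ∪ E_{v,x}`. [folklore] -/
theorem coe_Fp_subset_wireSet (h : ProbeHistory V) (e : Site 2 × MDir) {a a' : A} (ha' : a' ∈ S.Γ.anchSet a (tgt e)) (du : MDir) {j : ℕ}
    (hj : j ≤ S.Γ.K) : (↑(S.Fp G h e a a' du j) : Set (Sym2 V)) ⊆ wireSet (↑(S.Sx G h e a a' du) : Set V) := by
  rw [Fp, KNLevels.coe_pairsF]
  exact KozmaNitzan.wireSet_mono (Finset.coe_subset.2 (region_subset_Sx hSt h e ha' du hj))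

end Geometry

/-- `Fj ⊆ Fp`. [folklore] -/
theorem Fj_subset_Fp (h : ProbeHistory V) (e : Site 2 × MDir) (a a' : A) (du : MDir) (j : ℕ) :
    S.Fj G h e a a' du j ⊆ S.Fp G h e a a' du j :=
  edgesIn_subset_pairsF _

/-- `Fp` is monotone in the level. [folklore] -/
theorem Fp_mono (h : ProbeHistory V) (e : Site 2 × MDir) (a a' : A) (du : MDir) {j j' : ℕ} (hjj' : j ≤ j') :
    S.Fp G h e a a' du j ⊆ S.Fp G h e a a' du j' :=
  pairsF_mono (Finset.union_subset_union le_rfl (S.Γ.stub_mono _ _ _ hjj'))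

/-- The new edges of `E_i ∪ E_{w,v}` are pairs of every level. [folklore] -/
theorem baseF_subset_Fp (h : ProbeHistory V) (e : Site 2 × MDir) (a a' : A) (du : MDir) (j : ℕ) :
    S.baseF G h e a ⊆ S.Fp G h e a a' du j :=
  (S.baseF_subset_Fj h e a a' du j).trans (Fj_subset_Fp h e a a' du j)

/-! ## §3 Determination, measurability, consequences of validity, almost-sure facts -/

/-- `B_j` is determined by the conditioned edges of level `j`. [folklore] -/
theorem determinedBy_Bev (h : ProbeHistory V) (e : Site 2 × MDir) (a a' : A) (du : MDir) (j : ℕ) (δ₂ : ℝ) :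
    DeterminedBy (S.Bev G FD h e a a' du j δ₂) (↑(S.Fj G h e a a' du j) : Set (Sym2 V)) := by
  rw [determinedBy_iff]
  intro ω ω' hωω'
  have key : S.pat G h e a a' du j (obs ω (S.env G h e a)) = S.pat G h e a a' du j (obs ω' (S.env G h e a)) := by
    refine S.pat_congr h e a a' du j fun x hx => ?_
    have hxF : x ∈ S.Fj G h e a a' du j := (Finset.mem_sdiff.1 hx).1
    simp only [mem_obs_iff]
    refine and_congr_right fun _ => ⟨fun h1 => ?_, fun h1 => ?_⟩
    · exact ((Set.ext_iff.1 hωω' x).1 ⟨h1, Finset.mem_coe.2 hxF⟩).1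
    · exact ((Set.ext_iff.1 hωω' x).2 ⟨h1, Finset.mem_coe.2 hxF⟩).1
  simp only [Bev, Set.mem_setOf_eq, Wt, key]

/-- A bad direction (fixed departure anchor) is determined by the fresh conditioned edges of level `K - 1`. [folklore] -/
theorem determinedBy_badA (h : ProbeHistory V) (e : Site 2 × MDir) (a a' : A) (du : MDir) :
    DeterminedBy (S.badA G h e a a' du) (↑(S.Fj G h e a a' du (S.Γ.K - 1) \ S.F G h) : Set (Sym2 V)) := by
  rw [determinedBy_iff]
  intro ω ω' hωω'
  simp only [badA, Set.mem_setOf_eq]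
  refine forall₂_congr fun j hj => not_congr (S.cond_congr h e a a' du j fun x hx => ?_)
  have hx' : x ∈ S.Fj G h e a a' du (S.Γ.K - 1) \ S.F G h :=
    Finset.mem_sdiff.2 ⟨S.Fj_mono h e a a' du (by omega) (Finset.mem_sdiff.1 hx).1, (Finset.mem_sdiff.1 hx).2⟩
  simp only [mem_obs_iff]
  refine and_congr_right fun _ => ⟨fun h1 => ?_, fun h1 => ?_⟩
  · exact ((Set.ext_iff.1 hωω' x).1 ⟨h1, Finset.mem_coe.2 hx'⟩).1
  · exact ((Set.ext_iff.1 hωω' x).2 ⟨h1, Finset.mem_coe.2 hx'⟩).1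

/-- The chosen-anchor event is determined by the fresh edges of `E_i ∪ E_{w,v}`. [folklore] -/
theorem determinedBy_Dev (h : ProbeHistory V) (e : Site 2 × MDir) (a a' : A) :
    DeterminedBy (S.Dev G h e a a') (↑(S.baseF G h e a \ S.F G h) : Set (Sym2 V)) := by
  rw [determinedBy_iff]
  intro ω ω' hωω'
  simp only [Dev, Set.mem_setOf_eq]
  rw [S.depA_congr h e a (o := obs ω (S.env G h e a)) (o' := obs ω' (S.env G h e a)) fun x hx => ?_]
  simp only [mem_obs_iff]
  refine and_congr_right fun _ => ⟨fun h1 => ?_, fun h1 => ?_⟩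
  · exact ((Set.ext_iff.1 hωω' x).1 ⟨h1, Finset.mem_coe.2 hx⟩).1
  · exact ((Set.ext_iff.1 hωω' x).2 ⟨h1, Finset.mem_coe.2 hx⟩).1

/-- `A'_j` is determined by the pairs of level `j + 1`. [folklore] -/
theorem determinedBy_Aface (h : ProbeHistory V) (e : Site 2 × MDir) (a a' : A) (du : MDir) (j : ℕ) :
    DeterminedBy (S.Aface G FD h e a a' du j) (↑(S.Fp G h e a a' du (j + 1)) : Set (Sym2 V)) :=
  determinedBy_biUnion_openConnIn _ _ _ (by rw [Fp, KNLevels.coe_pairsF])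

/-- `A'_j` is measurable. [folklore] -/
theorem measurableSet_Aface [Countable V] (h : ProbeHistory V) (e : Site 2 × MDir) (a a' : A) (du : MDir) (j : ℕ) :
    MeasurableSet (S.Aface G FD h e a a' du j) :=
  measurableSet_biUnion_openConnIn _ _ _

/-- `G_j` is determined by the pairs of level `j`. [folklore] -/
theorem determinedBy_Gch (h : ProbeHistory V) (e : Site 2 × MDir) (a a' : A) (du : MDir) (δ₂ : ℝ) :
    ∀ j, DeterminedBy (S.Gch G FD h e a a' du δ₂ j) (↑(S.Fp G h e a a' du j) : Set (Sym2 V))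
  | 0 => determinedBy_univ _
  | j + 1 => by
    have hmono : (↑(S.Fp G h e a a' du j) : Set (Sym2 V)) ⊆ ↑(S.Fp G h e a a' du (j + 1)) :=
      Finset.coe_subset.2 (Fp_mono h e a a' du (Nat.le_succ j))
    refine (determinedBy_Aface h e a a' du j).inter (DeterminedBy.inter ?_ ((determinedBy_Gch h e a a' du δ₂ j).mono hmono))
    exact (determinedBy_Bev h e a a' du j δ₂).mono ((Finset.coe_subset.2 (Fj_subset_Fp h e a a' du j)).trans hmono)

section Setting

variable {h : ProbeHistory V} {e : Site 2 × MDir} (hV : S.Valid G h e) {a a' : A} (ha' : a' ∈ S.Γ.anchSet a (tgt e)) {du : MDir}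
  (hdu : du ∈ S.onward G h (tgt e)) (hSt : StepsGeom S.Γ FD)
include hV

/-- The explored edges are pairs of every level. [folklore] -/
theorem Valid.coe_F_subset_Fp (j : ℕ) : (↑(S.F G h) : Set (Sym2 V)) ⊆ ↑(S.Fp G h e a a' du j) :=
  Finset.coe_subset.2 ((S.F_subset_Fj hV.F_eq e a a' du j).trans (Fj_subset_Fp h e a a' du j))

/-- The explored edges are edges of `G`. [folklore] -/
theorem Valid.mem_edgeSet_of_mem_F {x : Sym2 V} (hx : x ∈ S.F G h) : x ∈ G.edgeSet := by
  rw [hV.F_eq, mem_edgesIn_iff] at hx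
  exact hx.1

include ha' hSt in
/-- The explored edges lie inside `E_i ∪ E_{w,v} ∪ E_{v,x}`. [folklore] -/
theorem Valid.coe_F_subset_wireSet : (↑(S.F G h) : Set (Sym2 V)) ⊆ wireSet (↑(S.Sx G h e a a' du) : Set V) :=
  (Valid.coe_F_subset_Fp hV 0).trans (coe_Fp_subset_wireSet hSt h e ha' du (Nat.zero_le _))

include ha' hSt in
/-- Under `μ` the pattern on the explored edges is the recorded one, almost surely. [folklore] -/
theorem Valid.ae_cyl : ∀ᵐ ω ∂prodBernoulli (S.Wfull G h e a a' du),
    ω ∈ localCylinder (↑(S.F G h) : Set (Sym2 V)) ↑(S.ξ G h) := by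
  have : S.Wfull G h e a a' du = pinW (restrW (↑(S.Sx G h e a a' du) : Set V) (KNLevels.lattW G S.p)) ↑(S.F G h) ↑(S.ξ G h) := by
    unfold Wfull
    exact restrW_pinW_comm _ _ (Valid.coe_F_subset_wireSet hV ha' hSt)
  rw [this]
  exact prodBernoulli_pinW_ae_localCylinder _ (S.F G h).finite_toSet.countable _

/-- Under `μ` no non-edge of `G` is open, almost surely. [folklore] -/
theorem Valid.ae_forall_notMem [Countable V] : ∀ᵐ ω ∂prodBernoulli (S.Wfull G h e a a' du),
    ∀ x ∈ {x : Sym2 V | x ∉ G.edgeSet}, x ∉ ω := by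
  refine prodBernoulli_ae_forall_notMem _ (Set.to_countable _) fun x hx => ?_
  unfold Wfull
  by_cases hxS : x ∈ wireSet (↑(S.Sx G h e a a' du) : Set V)
  · rw [restrW_apply_of_mem _ hxS, pinW_apply_of_not_mem _ _ (fun hxF => hx (Valid.mem_edgeSet_of_mem_F hV hxF))]
    rw [KNLevels.lattW_apply, if_neg hx]
  · exact restrW_apply_of_not_mem _ hxS

/-- Under `μ` every `lattOnly D` holds almost surely. [folklore] -/
theorem Valid.ae_lattOnly [Countable V] (D : Finset V) : ∀ᵐ ω ∂prodBernoulli (S.Wfull G h e a a' du), ω ∈ KNLevels.lattOnly G D := by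
  filter_upwards [Valid.ae_forall_notMem hV (a := a) (a' := a') (du := du)] with ω hω
  intro x _ hxω
  by_contra hx
  exact hω x hx hxω

/-! ## §4 The transfer: pinning `μ` on the pairs of level `j` gives the weighting of (30) -/

include ha' hdu hSt in
/-- **Under `μ` pinned on the pairs inside `E_i ∪ E_{w,v} ∪ H^j` along a lattice pattern `T` extending `ω|_{E_i}`, the weighting is that of (30)
at level `j` (fixed departure anchor `a'`) for the observation `T`.** [cite: KozmaNitzan2024, §4 p. 30 (Step III: "usual percolation on this
auxiliary graph is identical to conditioned percolation on Ω")] -/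
theorem pinW_Wfull_eq_Wt {j : ℕ} (hj : j < S.Γ.K) {T : Finset (Sym2 V)}
    (hTc : (↑T : Set (Sym2 V)) ∈ localCylinder (↑(S.F G h) : Set (Sym2 V)) ↑(S.ξ G h))
    (hTl : (↑T : Set (Sym2 V)) ∈ KNLevels.lattOnly G (S.Vx G h ∪ S.Γ.Ewv a e.1 e.2 ∪ S.Γ.Stub a' (tgt e) du j)) :
    pinW (S.Wfull G h e a a' du) ↑(S.Fp G h e a a' du j) ↑T = S.Wt G h e a a' du j (obs ↑T (S.env G h e a)) := by
  have hFpS := coe_Fp_subset_wireSet (G := G) hSt h e ha' du hj.le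
  funext x
  unfold Wt Wfull
  by_cases hxP : x ∈ S.Fp G h e a a' du j
  · have hxS : x ∈ wireSet (↑(S.Sx G h e a a' du) : Set V) := hFpS (Finset.mem_coe.2 hxP)
    rw [restrW_apply_of_mem _ hxS]
    by_cases hxj : x ∈ S.Fj G h e a a' du j
    · -- an edge of `G` of level `j`: both sides read the pattern
      have hiff : x ∈ (↑(S.pat G h e a a' du j (obs ↑T (S.env G h e a))) : Set (Sym2 V)) ↔ x ∈ (↑T : Set (Sym2 V)) := by
        rw [Finset.mem_coe, Finset.mem_coe, pat, Finset.mem_union, Finset.mem_inter, mem_obs_iff, Finset.mem_sdiff,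
          Finset.mem_coe]
        by_cases hxF : x ∈ S.F G h
        · have h1 := hTc x (Finset.mem_coe.2 hxF)
          rw [Finset.mem_coe, Finset.mem_coe] at h1
          constructor
          · rintro (h2 | ⟨-, -, h3⟩)
            · exact h1.2 h2
            · exact absurd hxF h3
          · intro h2; exact Or.inl (h1.1 h2)
        · have hxenv : x ∈ S.env G h e a := S.Fj_sdiff_subset_env h e a ha' hdu hj (Finset.mem_sdiff.2 ⟨hxj, hxF⟩)
          constructor
          · rintro (h2 | ⟨⟨-, h3⟩, -, -⟩)
            · exact absurd (hV.ξ_sub h2) hxF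
            · exact h3
          · intro h2; exact Or.inr ⟨⟨hxenv, h2⟩, hxj, hxF⟩
      by_cases hxT : x ∈ (↑T : Set (Sym2 V))
      · rw [pinW_apply_of_mem_of_mem _ (Finset.mem_coe.2 hxP) hxT,
          pinW_apply_of_mem_of_mem _ (Finset.mem_coe.2 hxj) (hiff.2 hxT)]
      · rw [pinW_apply_of_mem_of_not_mem _ (Finset.mem_coe.2 hxP) hxT,
          pinW_apply_of_mem_of_not_mem _ (Finset.mem_coe.2 hxj) (fun h' => hxT (hiff.1 h'))]
    · -- a non-edge pair of level `j`: closed on both sides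
      have hxE : x ∉ G.edgeSet := by
        intro hxE
        apply hxj
        rw [Fj, mem_edgesIn_iff]
        refine ⟨hxE, fun y hy => ?_⟩
        have := (Finset.mem_coe.2 hxP : x ∈ (↑(S.Fp G h e a a' du j) : Set (Sym2 V)))
        rw [Fp, KNLevels.coe_pairsF] at this
        exact Finset.mem_coe.1 (this.1 y hy)
      have hxT : x ∉ (↑T : Set (Sym2 V)) := fun hxT => hxE (hTl x hxP hxT)
      rw [pinW_apply_of_mem_of_not_mem _ (Finset.mem_coe.2 hxP) hxT, pinW_apply_of_not_mem _ _ (fun h' => hxj (Finset.mem_coe.1 h')),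
        KNLevels.lattW_apply, if_neg hxE]
  · have hxj : x ∉ (↑(S.Fj G h e a a' du j) : Set (Sym2 V)) := fun h' => hxP (Fj_subset_Fp h e a a' du j (Finset.mem_coe.1 h'))
    have hxF : x ∉ (↑(S.F G h) : Set (Sym2 V)) := fun h' => hxP (Finset.mem_coe.1 (Valid.coe_F_subset_Fp hV j h'))
    rw [pinW_apply_of_not_mem _ _ (fun h' => hxP (Finset.mem_coe.1 h'))]
    by_cases hxS : x ∈ wireSet (↑(S.Sx G h e a a' du) : Set V)
    · rw [restrW_apply_of_mem _ hxS, restrW_apply_of_mem _ hxS, pinW_apply_of_not_mem _ _ hxF, pinW_apply_of_not_mem _ _ hxj]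
    · rw [restrW_apply_of_not_mem _ hxS, restrW_apply_of_not_mem _ hxS]

end Setting

end KSchA

end KNCells

end Transplant

end Summit.CriticalPhenomena.PercolationContinuityZ3.Theorems

end
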